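import Summits.NavierStokesRegularity.NavierStokesRegularity.Theorems.SqueezeCycleExtremalElementExistsRegularity
import HarnessLib

/-!
# Uniform regularity of continuous Type-I Oseen-mild fields on windows `(A, 0) × ℝ³`
# (route `AdaptedFrequency`, item `TangentFlowTransfer`, stmt-NavierStokesRegularity-10494)

Helper file (all results proved): the windowed twin of
`SqueezeCycleExtremalElementExistsRegularity` (route `SqueezeCycle`). There the fields are
ancient (`(-∞, 0) × ℝ³`); the zoomed blow-up sequence `u_k(τ, y) = c_k u(T + c_k² τ, x₀ + c_k y)`
of a Type-I solution lives on windows `(A_k, 0) × ℝ³` with `A_k → −∞` only, so the blow-up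
compactness of `TangentFlowTransfer` needs the same statements for a field `u` which is jointly
continuous on `(A, 0) × ℝ³`, weakly divergence free, Oseen-mild between all times `A < s < t < 0`
and Type-I bounded there:

* `isKNSSDriftMild_window_of_window`: on every window `A < a < b < 0` the clamped shift is a
  restarted bounded mild field `IsKNSSDriftMild (b - a) (C/√(-b)) · 0` (KNSS 2009, §4 (i));
* `isSmoothSpaceTimeOn_window_of_window`, `contDiffOn_window_slab`: joint smoothness (Prop. 4.1);
* `exists_norm_iteratedFDeriv_le_of_typeI_window`, `exists_lipschitz_time_of_typeI_window`:
  bounds on `‖Dᵏu(t)(x)‖` and on the time-Lipschitz modulus of `Dᵏu(·)(x)` on `[a + δ, b) × ℝ³`,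
  uniform over all such fields with the same Type-I constant `C` and any `A < a` (KNSS (4.10),
  (4.11) via `KNSSBootstrap`).

The proofs are those of the ancient case verbatim, the clamp keeping all evaluations inside
`[a, b] ⊂ (A, 0)`.
-/

noncomputable section

open MeasureTheory Set Function Filter TopologicalSpace Metric
open scoped Topology NNReal ENNReal

namespace Summit.NavierStokesRegularity.NavierStokesRegularity.Theorems

open Literature.Analysis Literature.Analysis.FluidPDE

section Window

variable {C : ℝ} {u : ℝ → EuclideanSpace ℝ (Fin 3) → EuclideanSpace ℝ (Fin 3)}

/-- **Windowed version of `isKNSSDriftMild_window`: a continuous Type-I Oseen-mild field on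
`(A, 0) × ℝ³` is a restarted bounded mild field on every window `A < a < b < 0`** (KNSS 2009, §4 (i)): for `a < b < 0` the clamped shift
`V τ x = u (max a (min (τ + a) b)) x` satisfies `IsKNSSDriftMild (b - a) (C/√(-b)) V 0` — jointly
measurable (continuous), bounded by `C/√(-b)` on the window, weakly divergence free, and
`V(t) = e^{(t−s)Δ}V(s) − ∫ₛᵗ e^{(t−σ)Δ}P∇·(V⊗V)` for `0 < s < t < b - a`
(`driftDuhamel_zero_eq_oseenDuhamel`, `oseenDuhamel_translate`). [cite: KochNadirashviliSereginSverak2009, §4 (i) (arXiv:0709.3599v1 p. 8)] -/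
theorem isKNSSDriftMild_window_of_window {A : ℝ}
    (hc : ContinuousOn (uncurry u) (Ioo A 0 ×ˢ univ))
    (hdiv : ∀ t ∈ Ioo A 0, IsWeaklyDivFree (u t))
    (hmild : ∀ s t : ℝ, A < s → s < t → t < 0 → ∀ x,
      u t x = UnboundedOperators.heatExtension (u s) (t - s) x - oseenDuhamel 1 s u u t x)
    (hC : 0 ≤ C) (hI : ∀ t ∈ Ioo A 0, ∀ x, ‖u t x‖ ≤ C / Real.sqrt (-t)) {a b : ℝ} (hAa : A < a)
    (hab : a < b) (hb : b < 0) :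
    IsKNSSDriftMild (b - a) (C / Real.sqrt (-b)) (fun τ x => u (max a (min (τ + a) b)) x) 0 := by
  obtain ⟨hκc, hκmem, hκid⟩ := clampShift_facts hab.le
  have hN0 : 0 ≤ C / Real.sqrt (-b) := by positivity
  have hκneg : ∀ τ, max a (min (τ + a) b) < 0 := fun τ => (hκmem τ).2.trans_lt hb
  have hκA : ∀ τ, A < max a (min (τ + a) b) := fun τ => hAa.trans_le (hκmem τ).1
  have hκI : ∀ τ, max a (min (τ + a) b) ∈ Ioo A 0 := fun τ => ⟨hκA τ, hκneg τ⟩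
  have hcont : Continuous (uncurry fun τ x => u (max a (min (τ + a) b)) x) := by
    have hmap : Continuous fun p : ℝ × EuclideanSpace ℝ (Fin 3) =>
        (max a (min (p.1 + a) b), p.2) :=
      (hκc.comp continuous_fst).prodMk continuous_snd
    have hinto : ∀ p : ℝ × EuclideanSpace ℝ (Fin 3),
        (max a (min (p.1 + a) b), p.2) ∈ Ioo A (0 : ℝ) ×ˢ (univ : Set (EuclideanSpace ℝ (Fin 3))) :=
      fun p => ⟨hκI p.1, mem_univ _⟩
    exact (hc.comp_continuous hmap hinto).congr fun p => rfl
  have hslice : ∀ t ∈ Ioo A 0, Continuous (u t) := fun t ht =>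
    hc.comp_continuous (Continuous.prodMk_right t) fun x => ⟨ht, mem_univ x⟩
  have hbd : ∀ τ ∈ Ioo 0 (b - a), ∀ x, ‖u (max a (min (τ + a) b)) x‖ ≤ C / Real.sqrt (-b) := by
    intro τ hτ x
    rw [hκid τ ⟨hτ.1.le, hτ.2.le⟩]
    have hτa : τ + a < 0 := by linarith [hτ.2]
    have hτA : A < τ + a := by linarith [hτ.1]
    exact (hI (τ + a) ⟨hτA, hτa⟩ x).trans (div_sqrt_neg_le hC (neg_pos.2 hb) (by linarith [hτ.2]))
  refine IsKNSSDriftMild.mk measurable_const (fun t => by simpa using hN0) hcont.measurable hbd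
    ?_ ?_
  · exact Eventually.of_forall fun τ => hdiv _ (hκI τ)
  · intro s t hs hst htT x
    have hsid : max a (min (s + a) b) = s + a := hκid s ⟨hs.le, (hst.trans htT).le⟩
    have htid : max a (min (t + a) b) = t + a := hκid t ⟨(hs.trans hst).le, htT.le⟩
    have hVm : ∀ σ ∈ Ioo s t, Measurable fun x => u (max a (min (σ + a) b)) x := fun σ _ =>
      (hslice _ (hκI σ)).measurable
    have hVN : ∀ σ ∈ Ioo s t, ∀ y, ‖u (max a (min (σ + a) b)) y‖ ≤ C / Real.sqrt (-b) :=
      fun σ hσ y => hbd σ ⟨hs.trans hσ.1, hσ.2.trans htT⟩ y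
    rw [driftDuhamel_zero_eq_oseenDuhamel finrank_euclideanSpace_fin hVm hVN hst.le x]
    have hcongr : ∀ τ ∈ Ioo s t, (fun x => u (max a (min (τ + a) b)) x) = (fun σ => u (σ + a)) τ :=
      fun τ hτ => by
        funext y
        rw [hκid τ ⟨(hs.trans hτ.1).le, (hτ.2.trans htT).le⟩]
    rw [oseenDuhamel_congr_Ioo hcongr hcongr x, oseenDuhamel_translate]
    simp only [hsid, htid]
    have h := hmild (s + a) (t + a) (by linarith) (by linarith) (by linarith) x
    rwa [show t + a - (s + a) = t - s by ring] at h

/-- **Joint smoothness on a window** `A < a < b < 0` of a continuous Type-I Oseen-mild field on `(A, 0) × ℝ³`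
(KNSS 2009, Prop. 4.1 via `KNSS2009_prop41_mild_holds`, transported back along the shift
`t ↦ t - a`). [cite: KochNadirashviliSereginSverak2009, Prop. 4.1 (arXiv:0709.3599v1 p. 8)] -/
theorem isSmoothSpaceTimeOn_window_of_window {A : ℝ}
    (hc : ContinuousOn (uncurry u) (Ioo A 0 ×ˢ univ))
    (hdiv : ∀ t ∈ Ioo A 0, IsWeaklyDivFree (u t))
    (hmild : ∀ s t : ℝ, A < s → s < t → t < 0 → ∀ x,
      u t x = UnboundedOperators.heatExtension (u s) (t - s) x - oseenDuhamel 1 s u u t x)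
    (hC : 0 ≤ C) (hI : ∀ t ∈ Ioo A 0, ∀ x, ‖u t x‖ ≤ C / Real.sqrt (-t)) {a b : ℝ} (hAa : A < a)
    (hab : a < b) (hb : b < 0) :
    IsSmoothSpaceTimeOn (Ioo a b) u := by
  obtain ⟨-, -, hκid⟩ := clampShift_facts hab.le
  have hK := isKNSSDriftMild_window_of_window hc hdiv hmild hC hI hAa hab hb
  obtain ⟨ε, -, Cst, -, hP⟩ := KNSS2009_prop41_mild_holds 0
  obtain ⟨hsm, -⟩ := hP hK
  -- transport along `(t, x) ↦ (t - a, x)`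
  have hmap : ContDiff ℝ ((⊤ : ℕ∞) : WithTop ℕ∞)
      fun p : ℝ × EuclideanSpace ℝ (Fin 3) => (p.1 - a, p.2) :=
    (contDiff_fst.sub contDiff_const).prodMk contDiff_snd
  have hinto : MapsTo (fun p : ℝ × EuclideanSpace ℝ (Fin 3) => (p.1 - a, p.2)) (Ioo a b ×ˢ univ)
      (Ioo 0 (b - a) ×ˢ univ) := by
    rintro ⟨t, x⟩ ⟨ht, -⟩
    exact ⟨⟨by linarith [ht.1], by linarith [ht.2]⟩, mem_univ _⟩
  have hcomp := hsm.comp hmap.contDiffOn hinto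
  refine hcomp.congr ?_
  rintro ⟨t, x⟩ ⟨ht, -⟩
  simp only [comp_apply, uncurry_apply_pair]
  rw [hκid (t - a) ⟨by linarith [ht.1], by linarith [ht.2]⟩, sub_add_cancel]

/-- **Joint smoothness on the whole open window slab** `(A, 0) × ℝ³` (smoothness is local; every
`t ∈ (A, 0)` lies in a window `((A + t)/2, t/2)`). [cite: KochNadirashviliSereginSverak2009, Prop. 4.1 (arXiv:0709.3599v1 p. 8)] -/
theorem contDiffOn_window_slab {A : ℝ}
    (hc : ContinuousOn (uncurry u) (Ioo A 0 ×ˢ univ))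
    (hdiv : ∀ t ∈ Ioo A 0, IsWeaklyDivFree (u t))
    (hmild : ∀ s t : ℝ, A < s → s < t → t < 0 → ∀ x,
      u t x = UnboundedOperators.heatExtension (u s) (t - s) x - oseenDuhamel 1 s u u t x)
    (hC : 0 ≤ C) (hI : ∀ t ∈ Ioo A 0, ∀ x, ‖u t x‖ ≤ C / Real.sqrt (-t)) :
    ContDiffOn ℝ (⊤ : ℕ∞) (uncurry u) (Ioo A 0 ×ˢ univ) := by
  refine contDiffOn_of_locally_contDiffOn ?_
  rintro ⟨t, x⟩ ⟨ht, -⟩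
  obtain ⟨htA, ht0⟩ := ht
  refine ⟨Ioo ((A + t) / 2) (t / 2) ×ˢ univ, isOpen_Ioo.prod isOpen_univ,
    ⟨⟨by linarith, by linarith⟩, mem_univ _⟩, ?_⟩
  have h := isSmoothSpaceTimeOn_window_of_window hc hdiv hmild hC hI (a := (A + t) / 2) (b := t / 2)
    (by linarith) (by linarith) (by linarith)
  exact ContDiffOn.mono h inter_subset_right

/-! ### Uniform bounds over the class -/

/-- **Uniform bounds for all `x`-derivatives on a window, windowed class** (KNSS 2009, (4.10) via
`KNSSBootstrap.exists_norm_iteratedFDeriv_slice_le`): for `k`, a window `a < b < 0` and a margin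
`δ > 0` there is `K = K(k, a, b, δ, C)` with `‖Dᵏu(t)(x)‖ ≤ K` for all `t ∈ [a + δ, b)`, all `x`,
and **all** continuous Type-I Oseen-mild fields `u` on `(A, 0) × ℝ³`, `A < a`, with Type-I constant `C`.
[cite: KochNadirashviliSereginSverak2009, §4 (4.10) with Prop. 4.1 (4.6) (arXiv:0709.3599v1 p. 8)] -/
theorem exists_norm_iteratedFDeriv_le_of_typeI_window {C : ℝ} (hC : 0 ≤ C) (k : ℕ) {a b δ : ℝ}
    (hab : a < b) (hb : b < 0) (hδ : 0 < δ) :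
    ∃ K : ℝ, ∀ ⦃A : ℝ⦄ ⦃u : ℝ → EuclideanSpace ℝ (Fin 3) → EuclideanSpace ℝ (Fin 3)⦄, A < a →
      ContinuousOn (uncurry u) (Ioo A 0 ×ˢ univ) →
      (∀ t ∈ Ioo A 0, IsWeaklyDivFree (u t)) →
      (∀ s t : ℝ, A < s → s < t → t < 0 → ∀ x,
        u t x = UnboundedOperators.heatExtension (u s) (t - s) x - oseenDuhamel 1 s u u t x) →
      (∀ t ∈ Ioo A 0, ∀ x, ‖u t x‖ ≤ C / Real.sqrt (-t)) →
      ∀ t ∈ Ico (a + δ) b, ∀ x, ‖iteratedFDeriv ℝ k (u t) x‖ ≤ K := by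
  obtain ⟨Cf, hCf⟩ := KNSSBootstrap.exists_norm_iteratedFDeriv_slice_le
    (E := EuclideanSpace ℝ (Fin 3))
    finrank_euclideanSpace_fin (T := b - a) (N := C / Real.sqrt (-b)) k
  refine ⟨Cf δ, fun A u hAa hc hdiv hmild hI t ht x => ?_⟩
  obtain ⟨-, -, hκid⟩ := clampShift_facts hab.le
  have hK := isKNSSDriftMild_window_of_window hc hdiv hmild hC hI hAa hab hb
  have h : ‖iteratedFDeriv ℝ k (fun y => u (max a (min (t - a + a) b)) y) x‖ ≤ Cf δ :=
    hCf hK δ hδ (t - a) ⟨by linarith [ht.1], by linarith [ht.2]⟩ x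
  have hV : (fun y => u (max a (min (t - a + a) b)) y) = u t := by
    funext y; rw [hκid (t - a) ⟨by linarith [ht.1], by linarith [ht.2]⟩, sub_add_cancel]
  rwa [hV] at h

/-- **Uniform time-Lipschitz bounds for all `x`-derivatives on a window, windowed class** (KNSS 2009, (4.11)
via `KNSSBootstrap.exists_lipschitz_time_iteratedFDeriv`): for `k`, `a < b < 0`, `δ > 0` there
is `L = L(k, a, b, δ, C) ≥ 0` with `‖Dᵏu(t)(x) − Dᵏu(s)(x)‖ ≤ L |t − s|` for all
`s, t ∈ [a + δ, b)`, all `x`, and all continuous Type-I Oseen-mild fields `u` on `(A, 0) × ℝ³`,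
`A < a`, with Type-I constant `C`. [cite: KochNadirashviliSereginSverak2009, §4 (4.11) (arXiv:0709.3599v1 p. 8)] -/
theorem exists_lipschitz_time_of_typeI_window {C : ℝ} (hC : 0 ≤ C) (k : ℕ) {a b δ : ℝ}
    (hab : a < b) (hb : b < 0) (hδ : 0 < δ) :
    ∃ L : ℝ, 0 ≤ L ∧ ∀ ⦃A : ℝ⦄ ⦃u : ℝ → EuclideanSpace ℝ (Fin 3) → EuclideanSpace ℝ (Fin 3)⦄, A < a →
      ContinuousOn (uncurry u) (Ioo A 0 ×ˢ univ) →
      (∀ t ∈ Ioo A 0, IsWeaklyDivFree (u t)) →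
      (∀ s t : ℝ, A < s → s < t → t < 0 → ∀ x,
        u t x = UnboundedOperators.heatExtension (u s) (t - s) x - oseenDuhamel 1 s u u t x) →
      (∀ t ∈ Ioo A 0, ∀ x, ‖u t x‖ ≤ C / Real.sqrt (-t)) →
      ∀ s ∈ Ico (a + δ) b, ∀ t ∈ Ico (a + δ) b, ∀ x,
        ‖iteratedFDeriv ℝ k (u t) x - iteratedFDeriv ℝ k (u s) x‖ ≤ L * |t - s| := by
  obtain ⟨L, hL0, hL⟩ := KNSSBootstrap.exists_lipschitz_time_iteratedFDeriv
    (E := EuclideanSpace ℝ (Fin 3))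
    finrank_euclideanSpace_fin (T := b - a) (N := C / Real.sqrt (-b)) k hδ
  refine ⟨L, hL0, fun A u hAa hc hdiv hmild hI s hs t ht x => ?_⟩
  obtain ⟨-, -, hκid⟩ := clampShift_facts hab.le
  have hK := isKNSSDriftMild_window_of_window hc hdiv hmild hC hI hAa hab hb
  have h : ‖iteratedFDeriv ℝ k (fun y => u (max a (min (t - a + a) b)) y) x -
      iteratedFDeriv ℝ k (fun y => u (max a (min (s - a + a) b)) y) x‖ ≤ L * |t - a - (s - a)| :=
    hL hK (s - a) ⟨by linarith [hs.1], by linarith [hs.2]⟩ (t - a)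
      ⟨by linarith [ht.1], by linarith [ht.2]⟩ x
  have hVt : (fun y => u (max a (min (t - a + a) b)) y) = u t := by
    funext y; rw [hκid (t - a) ⟨by linarith [ht.1], by linarith [ht.2]⟩, sub_add_cancel]
  have hVs : (fun y => u (max a (min (s - a + a) b)) y) = u s := by
    funext y; rw [hκid (s - a) ⟨by linarith [hs.1], by linarith [hs.2]⟩, sub_add_cancel]
  rwa [hVt, hVs, show t - a - (s - a) = t - s by ring] at h

end Window

end Summit.NavierStokesRegularity.NavierStokesRegularity.Theorems

end
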